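import Summits.SmoothPoincare4.SmoothPoincare4.Theorems.ConvexBisectionAcyclicBisectionExistsHurwitzReduction
import Mathlib.Analysis.SpecificLimits.Basic
import HarnessLib

/-!
# The page clause at the deep belt circles, I: the limit argument (`c ≥ 0`)
(node N2 = `node_BELT` of the NF4 design, parent stub `stub_modelsOnFibred_of_reach`, line
`modp-braid-orbits`, crux `ConvexBisection.AcyclicBisectionExists`, item stmt-SmoothPoincare4-10508;
wave 2, worker V4, lead c5)

In a fibred model datum `(X, h, D, bX, Ψ)` over `Base g` (Kosinski multi-attachment data `D` of a
family `h` of 2-handle attaching maps whose attaching circles lie in the pages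
`page g (pageDir n k)`, boundary datum `bX`, a continuous `Ψ : ∂X → ∂ Base g` which is PAGE
PRESERVING on the seam: `bX.incl y = D.jA a → w (Ψ y) ∈ ℝ_{>0} · w a`), a boundary point
`bX.incl y = D.jB k b` of the `k`-th handle piece which is NOT on the seam (`∉ range D.jA`) is a
point of the deep belt circle `D.jB k {x_λ = 0, |x_μ| = 1}` (`lamSq_eq_zero_of_not_mem_range_jA`,
`norm_eq_one_of_jB_mem_boundary`), and it is the limit of the seam points
`D.jB k (sin s, 0, cos s · x_μ) = D.jA (h k (cos s, 0, sin s · x_μ))` (`s ↓ 0`, Kosinski's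
inversion `α`, `exists_tube_seq`), whose base points tend to the attaching circle, where
`w = pageDir n k / 2`.  Passing to the limit in the page clause (`exists_nonneg_of_tendsto`:
a limit of positive real multiples is a non-negative real multiple) gives
**`w (Ψ y) = c · pageDir n k` with `c ≥ 0`** (`belt_nonneg`, registered form
`helper_belt_pageRay`).  The sequel `…BeltPageClause.lean` upgrades this to `c > 0` for a
homeomorphism `Ψ` (a deep belt point cannot be glued onto the binding).  Everything here is
proved; no definitions, no named facts.  References: A. A. Kosinski, *Differential Manifolds*
(1993), VI §6 (the model `T`, `α`, belt disc) [Kosinski1993]; R. E. Gompf, A. I. Stipsicz,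
*4-Manifolds and Kirby Calculus* (1999), §8.2 [GompfStipsicz1999].
-/

noncomputable section

-- the prescribed namespace `Summit.<P>.<Sub>.…` duplicates `SmoothPoincare4` (P = Sub)
set_option linter.dupNamespace false

open scoped Manifold ContDiff Topology
open Set Function Filter Metric

namespace Summit.SmoothPoincare4.SmoothPoincare4.Theorems.AcyclicBisectionExists.ModpBraidOrbits

open Literature.Topology.FourManifolds Literature.Topology.FourManifolds.LefschetzBase
open Literature.Topology.FourManifolds.HandleAttachingMap

namespace BeltPageClause

universe u

/-! ## §1 A limit of positive real multiples is a non-negative real multiple -/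

/-- If `u = c • v` eventually along a filter with real `c > 0`, `u → U`, `v → V ≠ 0`, then
`U = c · V` for some real `c ≥ 0` (the quotients `u / v` are non-negative reals converging to
`U / V`, and the non-negative reals are closed in `ℂ`). [folklore] -/
theorem exists_nonneg_of_tendsto {α : Type*} {F : Filter α} [F.NeBot] {u v : α → ℂ} {U V : ℂ}
    (hu : Tendsto u F (𝓝 U)) (hv : Tendsto v F (𝓝 V)) (hV : V ≠ 0)
    (h : ∀ᶠ s in F, ∃ c : ℝ, 0 < c ∧ u s = (c : ℂ) * v s) : ∃ c : ℝ, 0 ≤ c ∧ U = (c : ℂ) * V := by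
  have hmem : ∀ᶠ s in F, u s / v s ∈ {z : ℂ | 0 ≤ z.re ∧ z.im = 0} := by
    filter_upwards [h, hv.eventually_ne hV] with s ⟨c, hc, hcs⟩ hvs
    rw [hcs, mul_div_assoc, div_self hvs, mul_one]
    exact ⟨by simp [hc.le], by simp⟩
  have hclosed : IsClosed {z : ℂ | 0 ≤ z.re ∧ z.im = 0} :=
    (isClosed_le continuous_const Complex.continuous_re).inter
      (isClosed_eq Complex.continuous_im continuous_const)
  have hlim : U / V ∈ {z : ℂ | 0 ≤ z.re ∧ z.im = 0} := hclosed.mem_of_tendsto (hu.div hv hV) hmem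
  refine ⟨(U / V).re, hlim.1, ?_⟩
  have hre : (((U / V).re : ℝ) : ℂ) = U / V := Complex.ext (by simp) (by simp [hlim.2])
  rw [hre, div_mul_cancel₀ U hV]

/-! ## §2 Model computations: seam points of the handle piece converging to the belt circle -/

/-- **Approximating a belt-circle point by glued boundary points.**  For `u = (0, 0, x_μ)`,
`|x_μ| = 1` (a point of the belt circle of `D⁴`), the tube points
`t_m = (cos s_m, 0, sin s_m · x_μ)`, `s_m = 1/(m+1)`, lie on `∂D⁴` strictly inside Kosinski's
punctured tube `0 < |x_λ| < 1`, tend to the point `(1, 0, 0, 0)` of the attaching circle, and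
their images `α(t_m) = (sin s_m, 0, cos s_m · x_μ)` under Kosinski's inversion tend to `u`.
[cite: Kosinski1993, VI §6] -/
theorem exists_tube_seq {u : EuclideanSpace ℝ (Fin 4)} (hu1 : ‖u‖ = 1) (hu0 : lamSq 2 u = 0) :
    ∃ (θ : Metric.sphere (0 : EuclideanSpace ℝ (Fin 2)) 1) (t : ℕ → EuclideanSpace ℝ (Fin 4)),
      (∀ m, ‖t m‖ = 1) ∧ (∀ m, 0 < lamSq 2 (t m)) ∧ (∀ m, lamSq 2 (t m) < 1) ∧
      Tendsto t atTop (𝓝 (corePt θ)) ∧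
      Tendsto (fun m => handleInversion 2 (t m)) atTop (𝓝 u) := by
  have h01 : u 0 ^ 2 + u 1 ^ 2 = 0 := by rw [← lamSq_two_fin_four]; exact hu0
  have hu_0 : u 0 = 0 := by nlinarith [sq_nonneg (u 0), sq_nonneg (u 1)]
  have hu_1 : u 1 = 0 := by nlinarith [sq_nonneg (u 0), sq_nonneg (u 1)]
  have hmu : u 2 ^ 2 + u 3 ^ 2 = 1 := by
    have h := lamSq_add_muSq 2 u
    rw [hu0, hu1, muSq_two_fin_four] at h
    linarith
  -- the two curves
  set γ : ℝ → EuclideanSpace ℝ (Fin 4) :=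
    fun s => WithLp.toLp 2 ![Real.cos s, 0, Real.sin s * u 2, Real.sin s * u 3] with hγ
  set β : ℝ → EuclideanSpace ℝ (Fin 4) :=
    fun s => WithLp.toLp 2 ![Real.sin s, 0, Real.cos s * u 2, Real.cos s * u 3] with hβ
  have hγc : Continuous γ := by
    refine (PiLp.continuous_toLp 2 _).comp (continuous_pi fun i => ?_)
    fin_cases i <;> simp <;> fun_prop
  have hβc : Continuous β := by
    refine (PiLp.continuous_toLp 2 _).comp (continuous_pi fun i => ?_)
    fin_cases i <;> simp <;> fun_prop
  have hγ_apply : ∀ s, γ s 0 = Real.cos s ∧ γ s 1 = 0 ∧ γ s 2 = Real.sin s * u 2 ∧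
      γ s 3 = Real.sin s * u 3 := fun s => ⟨rfl, rfl, rfl, rfl⟩
  have hβ_apply : ∀ s, β s 0 = Real.sin s ∧ β s 1 = 0 ∧ β s 2 = Real.cos s * u 2 ∧
      β s 3 = Real.cos s * u 3 := fun s => ⟨rfl, rfl, rfl, rfl⟩
  have hγ_lam : ∀ s, lamSq 2 (γ s) = Real.cos s ^ 2 := fun s => by
    rw [lamSq_two_fin_four, (hγ_apply s).1, (hγ_apply s).2.1]; ring
  have hγ_norm : ∀ s, ‖γ s‖ = 1 := fun s => by
    have h2 : ‖γ s‖ ^ 2 = 1 := by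
      rw [EuclideanSpace.norm_sq_eq, Fin.sum_univ_four]
      simp only [Real.norm_eq_abs, sq_abs, (hγ_apply s).1, (hγ_apply s).2.1, (hγ_apply s).2.2.1,
        (hγ_apply s).2.2.2]
      nlinarith [Real.sin_sq_add_cos_sq s]
    nlinarith [norm_nonneg (γ s)]
  -- Kosinski's inversion maps the tube curve to the belt curve
  have hinv : ∀ s, 0 < Real.sin s → 0 < Real.cos s → handleInversion 2 (γ s) = β s := by
    intro s hs hc
    have h1 : Real.sqrt (lamSq 2 (γ s)) = Real.cos s := by rw [hγ_lam, Real.sqrt_sq hc.le]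
    have h2 : Real.sqrt (1 - lamSq 2 (γ s)) = Real.sin s := by
      rw [hγ_lam, ← Real.sin_sq, Real.sqrt_sq hs.le]
    ext i
    fin_cases i
    · show handleInversion 2 (γ s) 0 = β s 0
      rw [handleInversion_apply, h1, h2, if_pos (by decide), (hγ_apply s).1, (hβ_apply s).1]
      field_simp
    · show handleInversion 2 (γ s) 1 = β s 1
      rw [handleInversion_apply, h1, h2, if_pos (by decide), (hγ_apply s).2.1, (hβ_apply s).2.1]
      ring
    · show handleInversion 2 (γ s) 2 = β s 2
      rw [handleInversion_apply, h1, h2, if_neg (by decide), (hγ_apply s).2.2.1,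
        (hβ_apply s).2.2.1]
      field_simp
    · show handleInversion 2 (γ s) 3 = β s 3
      rw [handleInversion_apply, h1, h2, if_neg (by decide), (hγ_apply s).2.2.2,
        (hβ_apply s).2.2.2]
      field_simp
  -- the parameter sequence
  set s : ℕ → ℝ := fun m => 1 / ((m : ℝ) + 1) with hs_def
  have hs : Tendsto s atTop (𝓝 0) := tendsto_one_div_add_atTop_nhds_zero_nat
  have hs_pos : ∀ m, 0 < s m := fun m => by positivity
  have hs_le : ∀ m, s m ≤ 1 := fun m => by
    rw [hs_def, div_le_one (by positivity)]
    linarith [(m.cast_nonneg : (0 : ℝ) ≤ m)]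
  have hsin : ∀ m, 0 < Real.sin (s m) := fun m =>
    Real.sin_pos_of_pos_of_lt_pi (hs_pos m) (by linarith [hs_le m, Real.pi_gt_three])
  have hcos : ∀ m, 0 < Real.cos (s m) := fun m => Real.cos_pos_of_mem_Ioo
    ⟨by linarith [hs_pos m, Real.pi_pos], by linarith [hs_le m, Real.pi_gt_three]⟩
  -- the limit point `(1, 0)` of the circle
  let θ : Metric.sphere (0 : EuclideanSpace ℝ (Fin 2)) 1 :=
    ⟨EuclideanSpace.single 0 1, by simp⟩
  have hγ0 : γ 0 = corePt θ := by
    ext i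
    fin_cases i
    · show γ 0 0 = corePt θ 0
      rw [corePt_apply_zero, (hγ_apply 0).1, Real.cos_zero]; simp [θ]
    · show γ 0 1 = corePt θ 1
      rw [corePt_apply_one, (hγ_apply 0).2.1]; simp [θ]
    · show γ 0 2 = corePt θ 2
      rw [corePt_apply_two, (hγ_apply 0).2.2.1, Real.sin_zero, zero_mul]
    · show γ 0 3 = corePt θ 3
      rw [corePt_apply_three, (hγ_apply 0).2.2.2, Real.sin_zero, zero_mul]
  have hβ0 : β 0 = u := by
    ext i
    fin_cases i
    · show β 0 0 = u 0
      rw [(hβ_apply 0).1, Real.sin_zero, hu_0]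
    · show β 0 1 = u 1
      rw [(hβ_apply 0).2.1, hu_1]
    · show β 0 2 = u 2
      rw [(hβ_apply 0).2.2.1, Real.cos_zero, one_mul]
    · show β 0 3 = u 3
      rw [(hβ_apply 0).2.2.2, Real.cos_zero, one_mul]
  refine ⟨θ, fun m => γ (s m), fun m => hγ_norm (s m), fun m => ?_, fun m => ?_, ?_, ?_⟩
  · rw [hγ_lam]; exact pow_pos (hcos m) 2
  · rw [hγ_lam]; nlinarith [Real.sin_sq_add_cos_sq (s m), hsin m]
  · have h := (hγc.tendsto 0).comp hs
    rwa [hγ0] at h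
  · have h := (hβc.tendsto 0).comp hs
    rw [hβ0] at h
    exact h.congr fun m => (hinv (s m) (hsin m) (hcos m)).symm

/-! ## §3 Point-set lemmas on Kosinski data -/

section PointSet

variable {M : Type u} [TopologicalSpace M] [T2Space M] [ChartedSpace (EuclideanHalfSpace 4) M]
  {ι : Type*} [Finite ι] {h : ι → HandleAttachingMap 3 2 M}
  {X : Type*} [TopologicalSpace X] [ChartedSpace (EuclideanHalfSpace 4) X]

/-- A tube point `h̄ₖ(t)` off the attaching circle (`|t_λ| ≠ 1`) is off ALL attaching circles
(injectivity of `h̄ₖ`, disjointness of the tubes). [folklore] -/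
theorem apply_mem_coresComplement_of_lamSq_ne_one
    (hdisj : Pairwise fun i j => Disjoint (range (h i).toFun) (range (h j).toFun)) (k : ι)
    (t : ↥(handleTube 3 2))
    (ht : lamSq 2 (((t : Metric.closedBall (0 : EuclideanSpace ℝ (Fin 4)) 1) :
      EuclideanSpace ℝ (Fin 4))) ≠ 1) :
    (h k).toFun t ∈ coresComplement h := by
  rw [mem_coresComplement]
  intro j hj
  obtain ⟨t', ht', he⟩ := (mem_core_iff _).1 hj
  by_cases hjk : j = k
  · subst hjk
    rw [← (h j).injective he] at ht
    exact ht ht'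
  · exact Set.disjoint_left.1 (hdisj hjk) (mem_range_self t') (by rw [he]; exact mem_range_self t)

/-- **The glued pair of a tube point**: `jA (h̄ₖ t) = jBₖ (α t)` for `t ∈ T ∖ S` (Kosinski's
identification, the `glue` clause of the data). [cite: Kosinski1993, VI §6] -/
theorem jA_apply_eq_jB (D : MultiAttachmentData h (𝓡∂ 4) X) (k : ι) (t : ↥(handleTube 3 2))
    (ht : lamSq 2 (((t : Metric.closedBall (0 : EuclideanSpace ℝ (Fin 4)) 1) :
      EuclideanSpace ℝ (Fin 4))) ≠ 1) :
    D.jA ⟨(h k).toFun t, apply_mem_coresComplement_of_lamSq_ne_one D.disjoint k t ht⟩ =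
      D.jB k ⟨⟨handleInversion 2 (((t : Metric.closedBall (0 : EuclideanSpace ℝ (Fin 4)) 1) :
        EuclideanSpace ℝ (Fin 4))), (handleInversion_mem t.2 ht).1⟩,
        (handleInversion_mem t.2 ht).2.2⟩ :=
  (D.glue k _ _).2 ⟨t, ht, rfl, rfl⟩

/-- **Deep points of a handle piece have `x_λ = 0`**: if `jBₖ b` is not a point of the base piece
`jA(M ∖ ⋃ h̄ᵢ(S))`, then `|b_λ|² = 0` (otherwise `b = α(α b)` is glued to `h̄ₖ(α b)`).
[cite: Kosinski1993, VI §6] -/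
theorem lamSq_eq_zero_of_not_mem_range_jA (D : MultiAttachmentData h (𝓡∂ 4) X) (k : ι)
    (b : ↥(beltPiece 3 2)) (hb : D.jB k b ∉ range D.jA) :
    lamSq 2 (((b : Metric.closedBall (0 : EuclideanSpace ℝ (Fin 4)) 1) :
      EuclideanSpace ℝ (Fin 4))) = 0 := by
  by_contra h0
  have h1 : lamSq 2 (((b : Metric.closedBall (0 : EuclideanSpace ℝ (Fin 4)) 1) :
      EuclideanSpace ℝ (Fin 4))) ≠ 1 := b.2
  set t : ↥(handleTube 3 2) := handleInversionPt (b : Metric.closedBall _ 1) h0 h1 with ht_def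
  have ht : lamSq 2 (((t : Metric.closedBall (0 : EuclideanSpace ℝ (Fin 4)) 1) :
      EuclideanSpace ℝ (Fin 4))) ≠ 1 := (handleInversion_mem h0 h1).2.2
  have h0' : 0 < lamSq 2 (((b : Metric.closedBall (0 : EuclideanSpace ℝ (Fin 4)) 1) :
      EuclideanSpace ℝ (Fin 4))) := lt_of_le_of_ne (lamSq_nonneg 2 _) (Ne.symm h0)
  have h1' : lamSq 2 (((b : Metric.closedBall (0 : EuclideanSpace ℝ (Fin 4)) 1) :
      EuclideanSpace ℝ (Fin 4))) < 1 :=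
    lt_of_le_of_ne (lamSq_le_one (mem_closedBall_zero_iff.1 b.1.2)) h1
  have hglue := jA_apply_eq_jB D k t ht
  have hbb : (⟨⟨handleInversion 2 (((t : Metric.closedBall (0 : EuclideanSpace ℝ (Fin 4)) 1) :
        EuclideanSpace ℝ (Fin 4))), (handleInversion_mem t.2 ht).1⟩,
        (handleInversion_mem t.2 ht).2.2⟩ : ↥(beltPiece 3 2)) = b := by
    apply Subtype.ext; apply Subtype.ext
    show handleInversion 2 (handleInversion 2 _) = _
    exact handleInversion_handleInversion h0' h1'
  rw [hbb] at hglue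
  exact hb ⟨_, hglue⟩

/-- **Boundary points of a handle piece lie on `∂D⁴`**: if `jBₖ b ∈ ∂X` then `‖b‖ = 1` (the open
smooth embedding `jBₖ` of the open submanifold `D⁴ ∖ S ⊆ D⁴` preserves boundary points;
`∂D⁴ = {‖x‖ = 1}`). [folklore] -/
theorem norm_eq_one_of_jB_mem_boundary (D : MultiAttachmentData h (𝓡∂ 4) X) (k : ι)
    (b : ↥(beltPiece 3 2)) (hb : D.jB k b ∈ (𝓡∂ 4).boundary X) :
    ‖(((b : Metric.closedBall (0 : EuclideanSpace ℝ (Fin 4)) 1) : EuclideanSpace ℝ (Fin 4)))‖ = 1 := by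
  have h1 : b ∈ (𝓡∂ 4).boundary ↥(beltPiece 3 2) :=
    (mem_boundary_iff_of_isSmoothEmbedding (D.hjB k).1 (D.hjB k).2 b).1 hb
  have h2 : (b : Metric.closedBall (0 : EuclideanSpace ℝ (Fin 4)) 1) ∈
      (𝓡∂ 4).boundary (Metric.closedBall (0 : EuclideanSpace ℝ (Fin 4)) 1) :=
    (mem_boundary_opens_iff (beltPiece 3 2) b).1 h1
  rw [boundary_closedBall] at h2
  exact h2

/-- Conversely, points of the handle piece on `∂D⁴` are boundary points of `X`. [folklore] -/
theorem jB_mem_boundary_of_norm_eq_one (D : MultiAttachmentData h (𝓡∂ 4) X) (k : ι)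
    (b : ↥(beltPiece 3 2))
    (hb : ‖(((b : Metric.closedBall (0 : EuclideanSpace ℝ (Fin 4)) 1) : EuclideanSpace ℝ (Fin 4)))‖ = 1) :
    D.jB k b ∈ (𝓡∂ 4).boundary X := by
  have h2 : (b : Metric.closedBall (0 : EuclideanSpace ℝ (Fin 4)) 1) ∈
      (𝓡∂ 4).boundary (Metric.closedBall (0 : EuclideanSpace ℝ (Fin 4)) 1) := by
    rw [boundary_closedBall]; exact hb
  exact (mem_boundary_iff_of_isSmoothEmbedding (D.hjB k).1 (D.hjB k).2 b).2
    ((mem_boundary_opens_iff (beltPiece 3 2) b).2 h2)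

end PointSet

/-! ## §4 The page clause passes to the limit at the deep belt circles (`c ≥ 0`) -/

section Belt

variable {g n : ℕ} {h : Fin n → HandleAttachingMap 3 2 (Base g)}
  {X : Type u} [TopologicalSpace X] [ChartedSpace (EuclideanHalfSpace 4) X]

/-- **The page clause extends by continuity to the deep belt circles, with a NON-NEGATIVE
factor.**  Data: multi-attachment data `D` of 2-handles `h` on `Base g` whose `k`-th attaching
circle lies in `page g (pageDir n k)`, a boundary datum `bX` of `X`, a continuous
`Ψ : ∂X → ∂ Base g`, page preserving on the seam (`bX.incl y = D.jA a → w (Ψ y) = c · w a`,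
`c > 0`).  Then a boundary point `bX.incl y = D.jB k b ∉ range D.jA` (a deep belt point) has
`w (Ψ y) = c · pageDir n k` with `c ≥ 0`: it is the limit of the glued boundary points
`D.jB k (α t_m) = D.jA (h k t_m)` of `exists_tube_seq`, `h k t_m →` a point of the attaching
circle (where `w = pageDir n k / 2`), and limits of positive multiples are non-negative multiples.
[cite: Kosinski1993, VI §6] -/
theorem belt_nonneg (D : MultiAttachmentData h (𝓡∂ 4) X) (bX : BoundaryData (𝓡∂ 4) X (𝓡 3))
    {Ψ : bX.carrier → (bBase g).carrier} (hΨ : Continuous Ψ) {k : Fin n}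
    (hk : ∀ θ, (h k).attachingCircle θ ∈ page g (pageDir n k))
    (hpage : ∀ (y : bX.carrier) (a : ↥(coresComplement h)), bX.incl y = D.jA a →
      ∃ c : ℝ, 0 < c ∧ w g ((bBase g).incl (Ψ y)).1 = (c : ℂ) * w g (a : Base g).1)
    {y : bX.carrier} {b : ↥(beltPiece 3 2)} (hy : bX.incl y = D.jB k b)
    (hdeep : bX.incl y ∉ range D.jA) :
    ∃ c : ℝ, 0 ≤ c ∧ w g ((bBase g).incl (Ψ y)).1 = (c : ℂ) * pageDir n k := by
  -- the belt point: `|b_λ| = 0`, `‖b‖ = 1`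
  have hb0 : lamSq 2 (((b : Metric.closedBall (0 : EuclideanSpace ℝ (Fin 4)) 1) :
      EuclideanSpace ℝ (Fin 4))) = 0 :=
    lamSq_eq_zero_of_not_mem_range_jA D k b (hy ▸ hdeep)
  have hb1 : ‖(((b : Metric.closedBall (0 : EuclideanSpace ℝ (Fin 4)) 1) :
      EuclideanSpace ℝ (Fin 4)))‖ = 1 :=
    norm_eq_one_of_jB_mem_boundary D k b (hy ▸ bX.incl_mem_boundary y)
  -- the approximating tube points
  obtain ⟨θ, t, ht1, ht0, ht1', htlim, hblim⟩ := exists_tube_seq hb1 hb0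
  let T : ℕ → ↥(handleTube 3 2) := fun m =>
    ⟨⟨t m, mem_closedBall_zero_iff.2 (ht1 m).le⟩, by rw [mem_handleTube]; exact (ht0 m).ne'⟩
  have hT1 : ∀ m, lamSq 2 (((T m : ↥(handleTube 3 2)) : Metric.closedBall
      (0 : EuclideanSpace ℝ (Fin 4)) 1) : EuclideanSpace ℝ (Fin 4)) ≠ 1 := fun m => (ht1' m).ne
  let B : ℕ → ↥(beltPiece 3 2) := fun m =>
    ⟨⟨handleInversion 2 (t m), (handleInversion_mem (T m).2 (hT1 m)).1⟩,
      (handleInversion_mem (T m).2 (hT1 m)).2.2⟩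
  let a : ℕ → ↥(coresComplement h) := fun m =>
    ⟨(h k).toFun (T m), apply_mem_coresComplement_of_lamSq_ne_one D.disjoint k (T m) (hT1 m)⟩
  have hglue : ∀ m, D.jA (a m) = D.jB k (B m) := fun m => jA_apply_eq_jB D k (T m) (hT1 m)
  -- the glued points are boundary points: `‖α t_m‖ = 1`
  have hB1 : ∀ m, ‖(((B m : ↥(beltPiece 3 2)) : Metric.closedBall (0 : EuclideanSpace ℝ (Fin 4)) 1) :
      EuclideanSpace ℝ (Fin 4))‖ = 1 := fun m =>
    (norm_handleInversion_eq_one_iff (ht1 m).le (ht0 m) (ht1' m)).2 (ht1 m)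
  have hBb : ∀ m, D.jB k (B m) ∈ range bX.incl := fun m => by
    rw [bX.range_incl]; exact jB_mem_boundary_of_norm_eq_one D k (B m) (hB1 m)
  choose Y hY using hBb
  -- convergence of the boundary points `Y m → y`
  have hBlim : Tendsto B atTop (𝓝 b) := by
    rw [tendsto_subtype_rng, tendsto_subtype_rng]
    exact hblim
  have hYlim : Tendsto Y atTop (𝓝 y) := by
    rw [bX.isSmoothEmbedding.isEmbedding.tendsto_nhds_iff]
    have h1 : Tendsto (fun m => D.jB k (B m)) atTop (𝓝 (D.jB k b)) :=
      ((D.hjB k).1.isEmbedding.continuous.tendsto b).comp hBlim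
    rw [hy]
    exact h1.congr fun m => (hY m).symm
  -- convergence of the base points `h k t_m →` the attaching circle
  have hTlim : Tendsto T atTop (𝓝 (coreTubePt θ)) := by
    rw [tendsto_subtype_rng, tendsto_subtype_rng]
    exact htlim
  have hwa : Tendsto (fun m => w g ((a m : ↥(coresComplement h)) : Base g).1) atTop
      (𝓝 (pageDir n k / 2)) := by
    have hf : Continuous fun s : ↥(handleTube 3 2) => w g ((h k).toFun s).1 :=
      (contDiff_w g).continuous.comp (continuous_subtype_val.comp (h k).continuous)
    have h1 := (hf.tendsto (coreTubePt θ)).comp hTlim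
    have h2 : w g ((h k).toFun (coreTubePt θ)).1 = pageDir n k / 2 := (hk θ).2
    rw [h2] at h1
    exact h1
  -- convergence of `w (Ψ (Y m))`
  have hW : Continuous fun z : bX.carrier => w g ((bBase g).incl (Ψ z)).1 :=
    (contDiff_w g).continuous.comp
      (continuous_subtype_val.comp ((bBase g).continuous_incl.comp hΨ))
  have hWlim : Tendsto (fun m => w g ((bBase g).incl (Ψ (Y m))).1) atTop
      (𝓝 (w g ((bBase g).incl (Ψ y)).1)) := (hW.tendsto y).comp hYlim
  -- the page clause along the sequence, and the limit
  have hev : ∀ᶠ m in atTop, ∃ c : ℝ, 0 < c ∧ w g ((bBase g).incl (Ψ (Y m))).1 =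
      (c : ℂ) * w g ((a m : ↥(coresComplement h)) : Base g).1 :=
    Eventually.of_forall fun m => hpage (Y m) (a m) ((hY m).trans (hglue m).symm)
  have hV : pageDir n k / 2 ≠ 0 := by
    rw [div_ne_zero_iff]
    exact ⟨fun h0 => by simpa [h0] using norm_pageDir n k, two_ne_zero⟩
  obtain ⟨c, hc, hcw⟩ := exists_nonneg_of_tendsto hWlim hwa hV hev
  refine ⟨c / 2, by positivity, ?_⟩
  rw [hcw]
  push_cast
  ring

end Belt

end BeltPageClause

open BeltPageClause

/-! ## §5 Registered helper -/

/-- **Registered helper `helper_belt_pageRay` (node N2 = BELT of NF4, limit half, wave 2, lead c5):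
in a fibred model datum every deep belt point of the seam is glued INTO THE CLOSED RAY of the page of
its letter**, `w (Ψ y) = c · pageDir n k` with `c ≥ 0` — for any continuous `Ψ : ∂X → ∂ Base g`
page preserving on the seam.  The companion file `…BeltPageClause.lean` gives `c > 0` for a
homeomorphism `Ψ`. [cite: Kosinski1993, VI §6] -/
theorem helper_belt_pageRay :
    ∀ (g : ℕ) (l : Literature.GroupTheory.CombinatorialGroupTheory.SignedHurwitz.IntWord g) (X :
      Type) [TopologicalSpace X] [ChartedSpace (EuclideanHalfSpace 4) X] (h : Fin l.length →
      Literature.Topology.FourManifolds.HandleAttachingMap 3 2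
      (Literature.Topology.FourManifolds.LefschetzBase.Base g)) (D :
      Literature.Topology.FourManifolds.HandleAttachingMap.MultiAttachmentData h (𝓡∂ 4) X) (bX :
      Literature.Topology.FourManifolds.BoundaryData (𝓡∂ 4) X (𝓡 3)) (Ψ : bX.carrier →
      (Literature.Topology.FourManifolds.LefschetzBase.bBase g).carrier), Continuous Ψ →
      Literature.Topology.FourManifolds.LefschetzBase.IsLefschetzLink g l h → (∀ (y : bX.carrier)
      (a : ↥(Literature.Topology.FourManifolds.HandleAttachingMap.coresComplement h)), bX.incl y =
      D.jA a → ∃ c : ℝ, 0 < c ∧ Literature.Topology.FourManifolds.LefschetzBase.w g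
      ((Literature.Topology.FourManifolds.LefschetzBase.bBase g).incl (Ψ y)).1 = (c : ℂ) *
      Literature.Topology.FourManifolds.LefschetzBase.w g (a :
      Literature.Topology.FourManifolds.LefschetzBase.Base g).1) → ∀ (y : bX.carrier) (k : Fin
      l.length) (b : ↥(Literature.Topology.FourManifolds.beltPiece 3 2)), bX.incl y = D.jB k b →
      bX.incl y ∉ Set.range D.jA → ∃ c : ℝ, 0 ≤ c ∧
      Literature.Topology.FourManifolds.LefschetzBase.w g
      ((Literature.Topology.FourManifolds.LefschetzBase.bBase g).incl (Ψ y)).1 = (c : ℂ) *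
      Literature.Topology.FourManifolds.LefschetzBase.pageDir l.length k :=
  fun _ _ _ _ _ _ D bX _ hΨ hl hpage _ k _ hy hdeep =>
    belt_nonneg D bX hΨ (hl.mem_page k) hpage hy hdeep

end Summit.SmoothPoincare4.SmoothPoincare4.Theorems.AcyclicBisectionExists.ModpBraidOrbits

end
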